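import Summits.Parity.GeneralizedHardyLittlewood.Theorems.GreenTaoLevelTwoGITwoCyclicInverseLinearSlice

/-!
# Route `GreenTaoLevelTwo`, crux `GITwo` (stmt-Parity-21275), line `birth`, stub `stub_cyclicInverse`:
# interface after GT08a §§5–6 and arXiv Lemma 44: from `‖f‖_{U³} ≥ η` to a graph slice

Eighteenth helper file toward the XL stub `stub_cyclicInverse` (B. Green, T. Tao, arXiv:math/0503014,
Thm. 68 = PEMS 51 (2008) Thm. 12.8).  It packages the chain landed so far into ONE statement for
the next step (arXiv Prop. 43): Gowers' argument (`…Derivatives`, `…Quadruples`), Balog–Szemerédi–Gowers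
and Prop. 27 (`…BSG*`, `…Affine`), and Lemma 44 (`…GraphFibre`, `…TorusBoxes`, `…GraphSlice`,
`…Separation`, `…LinearSlice`):

* `exists_graph_slice_of_gowersPower_three` — for `M` prime, `|f| ≤ 1` on `ℤ/Mℤ` and
  `‖f‖_{U³}^8 ≥ ε > 0` there are `H'' ⊆ ℤ/Mℤ`, `ξ : ℤ/Mℤ → ℤ/Mℤ` and `d ≤ (2²²⁵ε⁻¹⁶⁸)¹⁷` with
  (i) `|(Δ_t f)^(ξ_t)|² ≥ ε/2` for `t ∈ H''`, (ii) `#H'' ≥ ε¹⁷ M / (2²³ · 128^d)`, and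
  (iii) `4Γ'' − 4Γ''` is a graph, `Γ'' = {(t, ξ_t) : t ∈ H''}`.

What remains for arXiv Prop. 43 (not here): Bogolyubov (`…BogolyubovBohr`) on `H''` and the locally
linear `M : B(S', ¼) → ℤ/Mℤ` read off the graph `4Γ'' − 4Γ''`, then Prop. 45 and §9 Steps 2–4.

References: [GreenTao2008U3Inverse] arXiv:math/0503014, Prop. 24, Thm. 25, Prop. 27, Lemma 44.
-/

noncomputable section

namespace Summit.Parity.GeneralizedHardyLittlewood.GreenTaoLevelTwoGITwoCyclicInverse

open Finset
open scoped Pointwise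

open Literature.NumberTheory.Sieve

variable {M : ℕ} [NeZero M]

/-- **From `‖f‖_{U³} ≥ η` to a graph slice (GT08a §§5–6 + arXiv Lemma 44, qualitative constants).**
[cite: GreenTao2008U3Inverse, Prop. 27 and Lemma 44] -/
theorem exists_graph_slice_of_gowersPower_three (hM : M.Prime) {f : ZMod M → ℝ}
    (hf : ∀ x, |f x| ≤ 1) {ε : ℝ} (hε0 : 0 < ε) (hε : ε ≤ gowersPower 3 f) :
    ∃ (H'' : Finset (ZMod M)) (ξ : ZMod M → ZMod M) (d : ℕ),
      (d : ℝ) ≤ (2 ^ 225 / ε ^ 168) ^ 17 ∧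
      (∀ t ∈ H'', ε / 2 ≤ ‖dftCoeff (fun y => f y * f (y + t)) (ξ t)‖ ^ 2) ∧
      ε ^ 17 / 2 ^ 23 * M / (128 : ℝ) ^ d ≤ #H'' ∧
      Set.InjOn Prod.fst
        ((4 • (H''.image fun t => (t, ξ t)) - 4 • (H''.image fun t => (t, ξ t)) :
          Finset (ZMod M × ZMod M)) : Set (ZMod M × ZMod M)) := by
  obtain ⟨H', ξ, hH'card, hfreq, hΓ'card, hΓ'diff⟩ := exists_graph_small_difference hf hε0 hε
  have hMpos : (0 : ℝ) < M := by exact_mod_cast Nat.pos_of_ne_zero (NeZero.ne M)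
  set Γ' : Finset (ZMod M × ZMod M) := H'.image fun t => (t, ξ t) with hΓ'
  have hH'pos : (0 : ℝ) < #H' := lt_of_lt_of_le (by positivity) hH'card
  have hne : Γ'.Nonempty := by
    rw [← card_pos, hΓ'card]; exact_mod_cast hH'pos
  obtain ⟨d, Γ'', hd, hsub, hcard, hgraph4⟩ :=
    exists_slice_four_sub_four_graph hM Γ' hne (injOn_fst_image_graph H' ξ) hΓ'diff
  -- `Γ''` is the graph of `ξ` on `H'' = pr₁ Γ''`
  have hΓ''eq : Γ'' = (Γ''.image Prod.fst).image fun t => (t, ξ t) :=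
    eq_image_graph_of_subset H' ξ hsub
  have hH''card : #((Γ''.image Prod.fst).image fun t => (t, ξ t)) = #(Γ''.image Prod.fst) :=
    card_image_of_injective _ (graph_injective ξ)
  have hH''H' : Γ''.image Prod.fst ⊆ H' := by
    intro t ht
    obtain ⟨p, hp, rfl⟩ := mem_image.mp ht
    obtain ⟨s, hs, hsp⟩ := mem_image.mp (hsub hp)
    rw [← hsp]; exact hs
  refine ⟨Γ''.image Prod.fst, ξ, d, hd, fun t ht => hfreq t (hH''H' ht), ?_, ?_⟩
  · rw [← hH''card, ← hΓ''eq]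
    refine le_trans ?_ hcard
    rw [hΓ'card]
    exact div_le_div_of_nonneg_right hH'card (by positivity)
  · rw [← hΓ''eq]; exact hgraph4

end Summit.Parity.GeneralizedHardyLittlewood.GreenTaoLevelTwoGITwoCyclicInverse
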